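import Literature.NumberTheory.PAdicHodge.BdRPlusRamifiedLogEvalContinuity
import Literature.NumberTheory.PAdicHodge.BdRPlusLogTypeSeriesAdd
import Literature.NumberTheory.PAdicHodge.AinfRamifiedTorsionLiftAdd
import Literature.NumberTheory.PAdicHodge.AinfRamifiedOmegaPeriod
import HarnessLib

/-!
# Additivity of the ramified `p`-adic evaluation along a formal group law with `𝒪_D`-coefficients, at points of ARBITRARY depth

Topic `Literature/NumberTheory/PAdicHodge`; namespaces `Literature.NumberTheory.PAdicHodge.RamLogTypeSeries` (§1, pure algebra over a field `K`) and
`Literature.NumberTheory.PAdicHodge.AinfRam` / `AinfRamTop` (§2–§4). THEOREMS ONLY (no definition, no named fact, no instance, no `sorry`). The ramified,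
arbitrary-depth twin of `BdRPlusLogTypeSeriesAdd` (LEAD edix-p1 g21: `ℚ`-coefficient `f`, `ℤ`-coefficient law `G`, points in `(p,ξ)𝔸_inf`): here `f ∈ K⟦X⟧` for a
field `K` (e.g. `log_W` of `W/𝒪_D` read in `F`), the law `G ∈ A⟦X₀,X₁⟧` has coefficients in a ring `A → K` (e.g. `F_W`, `A = 𝒪_D`), and the points are
ANY `y, y′ ∈ Ŵ(𝔫_𝒪) ⊂ A_inf(𝒪)` (every element of `𝔫_𝒪 = θ_𝒪⁻¹(𝔪_ℂ)` is `(p,ω)`-adically nilpotent, `exists_pow_mem_ideal_of_norm_lt_one`).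
* §1 (`RamLogTypeSeries`, any field `K`, any `A →+* K`, any target ring `B`): the truncated functional equation with its error term,
  ★ `eval₂_sum_truncTotal_sub` — `Σ_{m<M} c_{m+1}G_D(z)^{m+1} − Σ c_{m+1}z₀^{m+1} − Σ c_{m+1}z₁^{m+1} = Σ c_{m+1}·H_{m+1}(z)` with `H_n ∈ A[X₀,X₁]` supported in
  total degrees `≥ M+1` (verbatim port of `LogTypeSeries.aeval_sum_truncTotal_sub` from `(ℤ, ℚ)` to `(A, K)`);
* §2 ★ `AinfRamTop.coe_evalPt_sub_aeval_truncTotal_mem_pow_div` — for `x₀, x₁ ∈ 𝔫_𝒪` with `xᵢ^N ∈ (p, ω)`: `evalPt f x − f_{≤D}(x) ∈ (p,ω)^{(D+1)/(2N)}`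
  (port of `AinfTop.coe_evalPt_sub_aeval_truncTotal_mem_pow_div` to `A_inf(𝒪)` and `𝒪_D`-coefficients);
* §3 ★ `AinfRam.inv_mul_toBdR_mem_lattice_of_mem_idealPXi_pow` — `(1/m)·ι_𝒪(c·x) ∈ Λ(j,k)` for `x ∈ ((p,ξ)A_inf(𝒪))^q`, `q ≥ j + 2r + k + v_p(m)` (the estimate
  behind `term_mem_lattice_of_pow_mem`, for arbitrary `x`); `AinfRamTop.mem_idealPXi_pow_of_mem_ideal_pow` (`(p,ω)^{2e·q} ⊆ ((p,ξ))^q`);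
* §4 ★★ `AinfRam.value_addW` — **ADDITIVITY**: if `f(G) = f(X₀) + f(X₁)` over `K = F`, `β_m/m = [Xᵐ]f` (`β : ℕ → 𝒪_D`), and `L`, `L′` are values modulo `Fil^k`
  of the series at `y`, `y′ ∈ Ŵ(𝔫_𝒪)`, then `L + L′` is a value at `y ⊕_G y′ = evalPt G (y, y′)` — at ANY depth.
Purpose: the `[p]_W`-functional equation `ev(log_W, [p]_W y) = p·ev(log_W, y)` along the SHALLOW levels of a `W_D`-tower (crux K★ `stmt-BirchSwinnertonDyer-22226`, line
`kato_lever`, memo `Lines/kato-lever-K2-hne-direct-omega.md` §1–§2, F2). Infrastructure only: BSD / K★ are not proved by any of this.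

## References
* J. H. Silverman, *The Arithmetic of Elliptic Curves* (2009), IV.2, IV.5.2. [SilvermanAEC2009]
* J.-M. Fontaine, *Le corps des périodes p-adiques*, Astérisque 223 (1994), Exp. II §1.5.3–1.5.4. [FontaineAsterisque223III]
* J.-M. Fontaine, *Formes différentielles et modules de Tate…*, Invent. Math. 65 (1982), §5. [Fontaine1982FormesDifferentielles]
* J. W. S. Cassels, A. Fröhlich (eds.), *Algebraic Number Theory* (1967), Ch. VI §3.2. [CasselsFrohlichANT1967]
-/

noncomputable section

open MvPowerSeries (truncTotal)

namespace Literature.NumberTheory.PAdicHodge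

/-! ## §1 The truncated functional equation over a field `K` with an integral structure `A → K` -/

namespace RamLogTypeSeries

open Finset MvPolynomial

variable {K : Type*} [Field K]

/-- For `a ∈ K⟦X₀,X₁⟧` without constant term and `|d| ≤ M`, `coeff_d(f(a)) = Σ_{n ≤ M} coeff_n(f) · coeff_d(aⁿ)`. [cite: SilvermanAEC2009, IV.2] -/
theorem coeff_subst_eq_sum (f : PowerSeries K) {a : MvPowerSeries (Fin 2) K} (ha : MvPowerSeries.constantCoeff a = 0)
    {d : Fin 2 →₀ ℕ} {M : ℕ} (hd : d.degree ≤ M) :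
    MvPowerSeries.coeff d (f.subst a) = ∑ n ∈ range (M + 1), PowerSeries.coeff n f * MvPowerSeries.coeff d (a ^ n) := by
  have hs : PowerSeries.HasSubst a := PowerSeries.HasSubst.of_constantCoeff_zero ha
  rw [PowerSeries.coeff_subst hs]
  refine (finsum_eq_sum_of_support_subset _ ?_).trans (Finset.sum_congr rfl fun n _ => smul_eq_mul _ _)
  intro n hn
  rw [Finset.mem_coe, Finset.mem_range]
  by_contra h
  have hlt : (d.degree : ℕ∞) < (a ^ n).order := lt_of_lt_of_le (by exact_mod_cast (show d.degree < n by omega))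
    (MvPowerSeries.le_order_pow_of_constantCoeff_eq_zero n ha)
  exact hn (by simp only [MvPowerSeries.coeff_of_lt_order hlt, smul_zero])

/-- The truncated functional equation, coefficientwise. [cite: SilvermanAEC2009, IV.5.2] -/
theorem sum_coeff_mul_coeff_truncTotal_pow (f : PowerSeries K) {G : MvPowerSeries (Fin 2) K} (hG0 : MvPowerSeries.constantCoeff G = 0)
    (hfG : f.subst G = f.subst (MvPowerSeries.X 0 : MvPowerSeries (Fin 2) K) + f.subst (MvPowerSeries.X 1 : MvPowerSeries (Fin 2) K))
    {d : Fin 2 →₀ ℕ} {M D : ℕ} (hd : d.degree ≤ M) (hMD : M ≤ D) :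
    ∑ n ∈ range (M + 1), PowerSeries.coeff n f * MvPolynomial.coeff d (truncTotal (D + 1) G ^ n) =
      ∑ n ∈ range (M + 1), PowerSeries.coeff n f *
        (MvPolynomial.coeff d ((X 0 : MvPolynomial (Fin 2) K) ^ n) + MvPolynomial.coeff d ((X 1 : MvPolynomial (Fin 2) K) ^ n)) := by
  have key := congrArg (MvPowerSeries.coeff d) hfG
  rw [map_add, coeff_subst_eq_sum f hG0 hd, coeff_subst_eq_sum f (MvPowerSeries.constantCoeff_X 0) hd,
    coeff_subst_eq_sum f (MvPowerSeries.constantCoeff_X 1) hd, ← Finset.sum_add_distrib] at key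
  have e1 : ∀ n : ℕ, MvPolynomial.coeff d (truncTotal (D + 1) G ^ n) = MvPowerSeries.coeff d (G ^ n) := fun n =>
    MvPowerSeries.coeff_truncTotal_pow G (by omega)
  have e2 : ∀ (i : Fin 2) (n : ℕ), MvPolynomial.coeff d ((X i : MvPolynomial (Fin 2) K) ^ n) =
      MvPowerSeries.coeff d ((MvPowerSeries.X i : MvPowerSeries (Fin 2) K) ^ n) := fun i n => by
    rw [← MvPolynomial.coeff_coe, MvPolynomial.coe_pow, MvPolynomial.coe_X]
  simp only [e1, e2, key]
  exact Finset.sum_congr rfl fun n _ => by ring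

/-- The truncated functional equation as a polynomial identity over `K`. [cite: SilvermanAEC2009, IV.5.2] -/
theorem sum_C_mul_truncTotal_pow (f : PowerSeries K) {G : MvPowerSeries (Fin 2) K} (hG0 : MvPowerSeries.constantCoeff G = 0)
    (hfG : f.subst G = f.subst (MvPowerSeries.X 0 : MvPowerSeries (Fin 2) K) + f.subst (MvPowerSeries.X 1 : MvPowerSeries (Fin 2) K))
    {M D : ℕ} (hMD : M ≤ D) :
    ∑ m ∈ range M, MvPolynomial.C (PowerSeries.coeff (m + 1) f) *
        truncTotal (M + 1) ((truncTotal (D + 1) G ^ (m + 1) : MvPolynomial (Fin 2) K) : MvPowerSeries (Fin 2) K) =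
      ∑ m ∈ range M, MvPolynomial.C (PowerSeries.coeff (m + 1) f) * (X 0 : MvPolynomial (Fin 2) K) ^ (m + 1) +
        ∑ m ∈ range M, MvPolynomial.C (PowerSeries.coeff (m + 1) f) * (X 1 : MvPolynomial (Fin 2) K) ^ (m + 1) := by
  classical
  refine MvPolynomial.ext _ _ fun d => ?_
  rw [MvPolynomial.coeff_add, MvPolynomial.coeff_sum, MvPolynomial.coeff_sum, MvPolynomial.coeff_sum]
  simp only [MvPolynomial.coeff_C_mul]
  by_cases hd : d.degree ≤ M
  · have hd' : d.degree < M + 1 := Nat.lt_succ_of_le hd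
    simp only [MvPowerSeries.coeff_truncTotal _ hd', MvPolynomial.coeff_coe]
    have key := sum_coeff_mul_coeff_truncTotal_pow f hG0 hfG hd hMD
    rw [Finset.sum_range_succ', Finset.sum_range_succ'] at key
    simp only [pow_zero, MvPolynomial.coeff_one] at key
    rw [← Finset.sum_add_distrib]
    have key' : ∑ m ∈ range M, PowerSeries.coeff (m + 1) f * MvPolynomial.coeff d (truncTotal (D + 1) G ^ (m + 1)) =
        ∑ m ∈ range M, PowerSeries.coeff (m + 1) f *
          (MvPolynomial.coeff d ((X 0 : MvPolynomial (Fin 2) K) ^ (m + 1)) + MvPolynomial.coeff d ((X 1 : MvPolynomial (Fin 2) K) ^ (m + 1))) := by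
      by_cases hd0 : 0 = d
      · subst hd0
        refine Finset.sum_congr rfl fun m _ => ?_
        have hz : ∀ q : MvPolynomial (Fin 2) K, MvPolynomial.constantCoeff q = 0 → MvPolynomial.coeff 0 (q ^ (m + 1)) = 0 := fun q hq => by
          rw [← MvPolynomial.constantCoeff_eq, map_pow, hq, zero_pow (Nat.succ_ne_zero m)]
        rw [hz _ (by rw [MvPolynomial.constantCoeff_eq, MvPowerSeries.coeff_truncTotal _ (by simp), MvPowerSeries.coeff_zero_eq_constantCoeff,
          hG0]), hz _ (MvPolynomial.constantCoeff_X K 0), hz _ (MvPolynomial.constantCoeff_X K 1), add_zero]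
      · simpa only [if_neg hd0, mul_zero, add_zero] using key
    rw [key']
    exact Finset.sum_congr rfl fun m _ => by ring
  · have hd' : M + 1 ≤ d.degree := by omega
    have hX : ∀ (i : Fin 2), ∀ m ∈ range M, PowerSeries.coeff (m + 1) f *
        MvPolynomial.coeff d ((X i : MvPolynomial (Fin 2) K) ^ (m + 1)) = 0 := by
      intro i m hm
      rw [MvPolynomial.coeff_X_pow, if_neg, mul_zero]
      rintro rfl
      rw [Finsupp.degree_single] at hd'
      exact absurd (Finset.mem_range.1 hm) (by omega)
    rw [Finset.sum_eq_zero (hX 0), Finset.sum_eq_zero (hX 1), add_zero]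
    exact Finset.sum_eq_zero fun m _ => by rw [MvPowerSeries.coeff_truncTotal_eq_zero _ hd', mul_zero]

variable {A : Type*} [CommRing A] (i : A →+* K)

/-- `H = qⁿ − truncTotal_{M+1}(qⁿ)` has no monomial of total degree `≤ M`. [cite: SilvermanAEC2009, IV.2] -/
theorem coeff_pow_sub_truncTotal_eq_zero (q : MvPolynomial (Fin 2) A) (n : ℕ) {M : ℕ}
    {d : Fin 2 →₀ ℕ} (hd : d.degree < M + 1) :
    MvPolynomial.coeff d (q ^ n - truncTotal (M + 1) ((q ^ n : MvPolynomial (Fin 2) A) : MvPowerSeries (Fin 2) A)) = 0 := by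
  rw [MvPolynomial.coeff_sub, MvPowerSeries.coeff_truncTotal _ hd, MvPolynomial.coeff_coe, sub_self]

/-- Base change `A → K` of `G_D = truncTotal_{D+1} G`. [cite: SilvermanAEC2009, IV.2] -/
theorem map_truncTotal (G : MvPowerSeries (Fin 2) A) (D : ℕ) :
    MvPolynomial.map i (truncTotal (D + 1) G) = truncTotal (D + 1) (MvPowerSeries.map i G) :=
  (MvPowerSeries.truncFinset_map _ _).symm

/-- Base change `A → K` of the polynomials `H_n = G_Dⁿ − truncTotal_{M+1}(G_Dⁿ)`. [cite: SilvermanAEC2009, IV.2] -/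
theorem map_pow_sub_truncTotal (G : MvPowerSeries (Fin 2) A) (M D n : ℕ) :
    MvPolynomial.map i (truncTotal (D + 1) G ^ n - truncTotal (M + 1) ((truncTotal (D + 1) G ^ n : MvPolynomial (Fin 2) A) : MvPowerSeries (Fin 2) A)) =
      truncTotal (D + 1) (MvPowerSeries.map i G) ^ n -
        truncTotal (M + 1) ((truncTotal (D + 1) (MvPowerSeries.map i G) ^ n : MvPolynomial (Fin 2) K) : MvPowerSeries (Fin 2) K) := by
  have hG : MvPolynomial.map i (truncTotal (D + 1) G ^ n) = truncTotal (D + 1) (MvPowerSeries.map i G) ^ n := by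
    rw [map_pow, map_truncTotal]
  refine MvPolynomial.ext _ _ fun d => ?_
  rw [MvPolynomial.coeff_map, MvPolynomial.coeff_sub, MvPolynomial.coeff_sub, map_sub, ← MvPolynomial.coeff_map, hG,
    MvPowerSeries.coeff_truncTotal_eq_ite, MvPowerSeries.coeff_truncTotal_eq_ite, MvPolynomial.coeff_coe, MvPolynomial.coeff_coe]
  split_ifs with h
  exacts [by rw [← MvPolynomial.coeff_map, hG], by rw [map_zero]]

/-- ★ **The truncated functional equation with its error term, over `(A, K)` and in any target ring `B`.** For `f ∈ K⟦X⟧`, `G ∈ A⟦X₀,X₁⟧` with `G(0) = 0`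
and `f(G) = f(X₀) + f(X₁)` after base change `i : A → K`, ring maps `eK : K → B`, `eA : A → B` with `eK ∘ i = eA`, points `z : Fin 2 → B`, `M ≤ D`:
`Σ_{m<M} eK(c_{m+1})·G_D(z)^{m+1} − Σ eK(c_{m+1})·z₀^{m+1} − Σ eK(c_{m+1})·z₁^{m+1} = Σ_{m<M} eK(c_{m+1})·H_{m+1}(z)`, `H_n = G_Dⁿ − truncTotal_{M+1}(G_Dⁿ) ∈ A[X₀,X₁]`
supported in degrees `≥ M+1`. [cite: SilvermanAEC2009, IV.5.2] -/
theorem eval₂_sum_truncTotal_sub {B : Type*} [CommRing B] (eK : K →+* B) (eA : A →+* B) (heA : eK.comp i = eA) (f : PowerSeries K)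
    {G : MvPowerSeries (Fin 2) A} (hG0 : MvPowerSeries.constantCoeff G = 0)
    (hfG : f.subst (MvPowerSeries.map i G) = f.subst (MvPowerSeries.X 0 : MvPowerSeries (Fin 2) K) + f.subst (MvPowerSeries.X 1 : MvPowerSeries (Fin 2) K))
    {M D : ℕ} (hMD : M ≤ D) (z : Fin 2 → B) :
    ∑ m ∈ range M, eK (PowerSeries.coeff (m + 1) f) * MvPolynomial.eval₂ eA z (truncTotal (D + 1) G) ^ (m + 1) -
        ∑ m ∈ range M, eK (PowerSeries.coeff (m + 1) f) * z 0 ^ (m + 1) -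
        ∑ m ∈ range M, eK (PowerSeries.coeff (m + 1) f) * z 1 ^ (m + 1) =
      ∑ m ∈ range M, eK (PowerSeries.coeff (m + 1) f) *
        MvPolynomial.eval₂ eA z (truncTotal (D + 1) G ^ (m + 1) -
          truncTotal (M + 1) ((truncTotal (D + 1) G ^ (m + 1) : MvPolynomial (Fin 2) A) : MvPowerSeries (Fin 2) A)) := by
  set Gq : MvPowerSeries (Fin 2) K := MvPowerSeries.map i G with hGq
  have hGq0 : MvPowerSeries.constantCoeff Gq = 0 := by
    rw [hGq, ← MvPowerSeries.coeff_zero_eq_constantCoeff, MvPowerSeries.coeff_map, MvPowerSeries.coeff_zero_eq_constantCoeff, hG0, map_zero]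
  -- universal case in `K[X₀, X₁]`
  have univ : ∑ m ∈ range M, MvPolynomial.C (PowerSeries.coeff (m + 1) f) * (truncTotal (D + 1) Gq) ^ (m + 1) -
      ∑ m ∈ range M, MvPolynomial.C (PowerSeries.coeff (m + 1) f) * (X 0 : MvPolynomial (Fin 2) K) ^ (m + 1) -
      ∑ m ∈ range M, MvPolynomial.C (PowerSeries.coeff (m + 1) f) * (X 1 : MvPolynomial (Fin 2) K) ^ (m + 1) =
      ∑ m ∈ range M, MvPolynomial.C (PowerSeries.coeff (m + 1) f) *
        ((truncTotal (D + 1) Gq) ^ (m + 1) - truncTotal (M + 1) (((truncTotal (D + 1) Gq) ^ (m + 1) : MvPolynomial (Fin 2) K) :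
          MvPowerSeries (Fin 2) K)) := by
    rw [sub_sub, ← sum_C_mul_truncTotal_pow f hGq0 hfG hMD, ← Finset.sum_sub_distrib]
    exact Finset.sum_congr rfl fun m _ => by rw [mul_sub]
  -- specialise along `eval₂ eK z`
  have h := congrArg (MvPolynomial.eval₂ eK z) univ
  simp only [MvPolynomial.eval₂_sub, MvPolynomial.eval₂_sum, MvPolynomial.eval₂_mul, MvPolynomial.eval₂_pow, MvPolynomial.eval₂_C,
    MvPolynomial.eval₂_X] at h
  have hGD : MvPolynomial.eval₂ eK z (truncTotal (D + 1) Gq) = MvPolynomial.eval₂ eA z (truncTotal (D + 1) G) := by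
    rw [hGq, ← map_truncTotal, MvPolynomial.eval₂_map, heA]
  have hH : ∀ n : ℕ, MvPolynomial.eval₂ eK z (truncTotal (D + 1) Gq ^ n) -
      MvPolynomial.eval₂ eK z (truncTotal (M + 1) ((truncTotal (D + 1) Gq ^ n : MvPolynomial (Fin 2) K) : MvPowerSeries (Fin 2) K)) =
      MvPolynomial.eval₂ eA z (truncTotal (D + 1) G ^ n -
        truncTotal (M + 1) ((truncTotal (D + 1) G ^ n : MvPolynomial (Fin 2) A) : MvPowerSeries (Fin 2) A)) := fun n => by
    rw [← MvPolynomial.eval₂_sub, hGq, ← map_pow_sub_truncTotal i G M D n, MvPolynomial.eval₂_map, heA]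
  rw [hGD] at h
  rw [h]
  exact Finset.sum_congr rfl fun m _ => by rw [← hGD, ← MvPolynomial.eval₂_pow, hH]

/-- A polynomial over `A` supported in total degrees `≥ N` evaluates into `I^N` when the variables are sent into `I`. [folklore] -/
private theorem eval₂_mem_pow_of_coeff_eq_zero {σ R : Type*} [CommRing R] (e : A →+* R) {I : Ideal R} {y : σ → R} (hy : ∀ i, y i ∈ I)
    {q : MvPolynomial σ A} {N : ℕ} (hq : ∀ d : σ →₀ ℕ, d.degree < N → MvPolynomial.coeff d q = 0) :
    MvPolynomial.eval₂ e y q ∈ I ^ N := by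
  rw [MvPolynomial.as_sum q, MvPolynomial.eval₂_sum]
  refine Ideal.sum_mem _ fun d hd => ?_
  have hN : N ≤ d.degree := not_lt.1 fun h => (MvPolynomial.mem_support_iff.1 hd) (hq d h)
  rw [MvPolynomial.eval₂_monomial]
  refine Ideal.mul_mem_left _ _ (Ideal.pow_le_pow_right hN ?_)
  rw [Finsupp.prod, Finsupp.degree_apply, ← Finset.prod_pow_eq_pow_sum]
  exact Ideal.prod_mem_prod fun j _ => Ideal.pow_mem_pow (hy j) _

/-- `H_n(y, y') ∈ I^{M+1}` for `y, y' ∈ I`. [cite: SilvermanAEC2009, IV.2] -/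
theorem eval₂_pow_sub_truncTotal_mem_pow {R : Type*} [CommRing R] (e : A →+* R) {I : Ideal R} {y : Fin 2 → R} (hy : ∀ j, y j ∈ I)
    (G : MvPowerSeries (Fin 2) A) (M D n : ℕ) :
    MvPolynomial.eval₂ e y (truncTotal (D + 1) G ^ n -
        truncTotal (M + 1) ((truncTotal (D + 1) G ^ n : MvPolynomial (Fin 2) A) : MvPowerSeries (Fin 2) A)) ∈ I ^ (M + 1) :=
  eval₂_mem_pow_of_coeff_eq_zero e hy fun _ hd => coeff_pow_sub_truncTotal_eq_zero _ _ hd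

end RamLogTypeSeries

/-! ## §2 Truncation of `evalPt` at `(p, ω)`-nilpotent points of `A_inf(𝒪)` -/

namespace AinfRamTop

open Ideal Filter Topology MvPowerSeries ValuativeRel Field WittVector
open Literature.NumberTheory.GaloisRepresentations Literature.NumberTheory.GaloisRepresentations.IsNonarchimedeanLocalField
open Literature.NumberTheory.GaloisRepresentations.LubinTate

variable {F : Type} [Field F] [ValuativeRel F] [TopologicalSpace F] [IsNonarchimedeanLocalField F] [CharZero F]
  {p : ℕ} [Fact p.Prime] [Fact (¬ IsUnit (p : integerC F))] [IsAdicComplete (Ideal.span {(p : integerC F)}) (integerC F)]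
  {hp : valuation F p < 1} {D : EisensteinRoot F p hp} {hθ : Function.Surjective (fontaineTheta (integerC F) p)}

/-- `(x₀, x₁)^{N+N} ⊆ J` when `x₀^N, x₁^N ∈ J`. [folklore] -/
private theorem sup_span_pow_le_of_pow_mem' {R : Type*} [CommRing R] {J : Ideal R} {a b : R} {N : ℕ} (ha : a ^ N ∈ J) (hb : b ^ N ∈ J) :
    (Ideal.span {a} ⊔ Ideal.span {b}) ^ (N + N) ≤ J := by
  refine Ideal.sup_pow_add_le_pow_sup_pow.trans (sup_le ?_ ?_)
  · rw [Ideal.span_singleton_pow, Ideal.span_singleton_le_iff_mem]; exact ha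
  · rw [Ideal.span_singleton_pow, Ideal.span_singleton_le_iff_mem]; exact hb

/-- A monomial of degree `|d|` in `(x₀, x₁)` lies in `(x₀, x₁)^{|d|}`. [folklore] -/
private theorem prod_pow_mem_sup_pow' {R : Type*} [CommRing R] (y : Fin 2 → R) (d : Fin 2 →₀ ℕ) :
    (d.prod fun i e => y i ^ e) ∈ (Ideal.span {y 0} ⊔ Ideal.span {y 1}) ^ d.degree := by
  have hy : ∀ i : Fin 2, y i ∈ Ideal.span {y 0} ⊔ Ideal.span {y 1} := by
    intro i; fin_cases i
    · exact Ideal.mem_sup_left (Ideal.mem_span_singleton_self _)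
    · exact Ideal.mem_sup_right (Ideal.mem_span_singleton_self _)
  rw [Finsupp.prod, Finsupp.degree_apply, ← Finset.prod_pow_eq_pow_sum]
  exact Ideal.prod_mem_prod fun i _ => Ideal.pow_mem_pow (hy i) _

/-- ★ **`evalPt f x − f_{≤T}(x) ∈ (p, ω)^{(T+1)/(2N)}` at `(p, ω)`-nilpotent points of `A_inf(𝒪)`** (`xᵢ^N ∈ (p, ω)`), for an `𝒪_D`-integral series
`f ∈ 𝒪_D⟦X₀,X₁⟧` without constant term — the ramified twin of `AinfTop.coe_evalPt_sub_aeval_truncTotal_mem_pow_div`. [cite: CasselsFrohlichANT1967, Ch. VI §3.2] -/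
theorem coe_evalPt_sub_aeval_truncTotal_mem_pow_div (f : MvPowerSeries (Fin 2) (EisensteinRoot.CoeffDisc D)) (hf : f.constantCoeff = 0)
    (x : Fin 2 → (nilTheta D hθ).toIdeal) {N : ℕ} (hx : ∀ i, (x i : AinfRamTop D) ^ N ∈ (WithIdeal.i : Ideal (AinfRamTop D))) (T : ℕ) :
    ((evalPt (nilTheta D hθ) f hf x : (nilTheta D hθ).toIdeal) : AinfRamTop D) -
        MvPolynomial.aeval (fun i => (x i : AinfRamTop D)) (truncTotal (T + 1) f) ∈
      (WithIdeal.i : Ideal (AinfRamTop D)) ^ ((T + 1) / (N + N)) := by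
  classical
  have hev := (nilTheta D hθ).hasEval x
  set g : MvPowerSeries (Fin 2) (EisensteinRoot.CoeffDisc D) :=
    f - ((truncTotal (T + 1) f : MvPolynomial (Fin 2) (EisensteinRoot.CoeffDisc D)) : MvPowerSeries (Fin 2) (EisensteinRoot.CoeffDisc D)) with hg
  have hsplit : ((evalPt (nilTheta D hθ) f hf x : (nilTheta D hθ).toIdeal) : AinfRamTop D) -
      MvPolynomial.aeval (fun i => (x i : AinfRamTop D)) (truncTotal (T + 1) f) = MvPowerSeries.aeval hev g := by
    rw [coe_evalPt, hg, map_sub, MvPowerSeries.aeval_coe]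
  rw [hsplit]
  set q := (T + 1) / (N + N) with hq
  have hJ : (Ideal.span {(x 0 : AinfRamTop D)} ⊔ Ideal.span {(x 1 : AinfRamTop D)}) ^ (N + N) ≤ (WithIdeal.i : Ideal (AinfRamTop D)) :=
    sup_span_pow_le_of_pow_mem' (hx 0) (hx 1)
  have hterm : ∀ d : Fin 2 →₀ ℕ, MvPowerSeries.coeff d g • (d.prod fun i e => (x i : AinfRamTop D) ^ e) ∈
      (WithIdeal.i : Ideal (AinfRamTop D)) ^ q := by
    intro d
    by_cases hd : d.degree < T + 1
    · have h0 : MvPowerSeries.coeff d g = 0 := by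
        rw [hg, map_sub, MvPolynomial.coeff_coe, MvPowerSeries.coeff_truncTotal _ hd, sub_self]
      rw [h0, zero_smul]
      exact Submodule.zero_mem _
    · refine Submodule.smul_of_tower_mem _ _ ?_
      have h1 := prod_pow_mem_sup_pow' (fun i => (x i : AinfRamTop D)) d
      have hle : (Ideal.span {(x 0 : AinfRamTop D)} ⊔ Ideal.span {(x 1 : AinfRamTop D)}) ^ d.degree ≤
          (WithIdeal.i : Ideal (AinfRamTop D)) ^ q := by
        refine (Ideal.pow_le_pow_right (show (N + N) * q ≤ d.degree from ?_)).trans ?_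
        · rw [hq]; nlinarith [Nat.div_mul_le_self (T + 1) (N + N)]
        · rw [pow_mul]; exact Ideal.pow_right_mono hJ q
      exact hle h1
  refine (isClosed_of_pow_le (D := D) (le_refl ((WithIdeal.i : Ideal (AinfRamTop D)) ^ q))).mem_of_tendsto (MvPowerSeries.hasSum_aeval hev g)
    (Filter.Eventually.of_forall fun s => ?_)
  exact Ideal.sum_mem _ fun d _ => hterm d

/-- **Depth of a point of `𝔫_𝒪`**: every `a ∈ 𝔫_𝒪` has a power in `(p, ω)` — with exponent at least `1`. [cite: FontaineAsterisque223III, Exp. II §1.3] -/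
theorem exists_pos_pow_mem_ideal (a : (nilTheta D hθ).toIdeal) : ∃ N : ℕ, 1 ≤ N ∧ (a : AinfRamTop D) ^ N ∈ (WithIdeal.i : Ideal (AinfRamTop D)) := by
  obtain ⟨N, hN⟩ := exists_pow_mem_ideal_of_norm_lt_one (D := D) hθ (mem_nilTheta_iff.1 a.2)
  exact ⟨N + 1, by omega, by rw [pow_succ]; exact Ideal.mul_mem_right _ _ hN⟩

/-- **`(p, ω)^{2e·q} ⊆ ((p, ξ)A_inf(𝒪))^q`** on elements, read in `AinfRam D` (`ω^{2e−1} ∈ (p, ξ)`, `ideal_pow_le_map_idealPXi`).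
[cite: FarguesFontaine2018, §1.2] -/
theorem of_symm_mem_idealPXi_pow {q : ℕ} {a : AinfRamTop D} (ha : a ∈ (WithIdeal.i : Ideal (AinfRamTop D)) ^ ((1 + (D.e + D.e - 1)) * q)) :
    (of D).symm a ∈ AinfRam.idealPXi D ^ q := by
  have h1 : a ∈ ((AinfRam.idealPXi D).map (of D).toRingHom) ^ q := by
    rw [pow_mul] at ha
    exact Ideal.pow_right_mono (ideal_pow_le_map_idealPXi D) q ha
  rw [← Ideal.map_pow, RingEquiv.toRingHom_eq_coe, Ideal.map_comap_of_equiv, Ideal.mem_comap] at h1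
  exact h1

end AinfRamTop

/-! ## §3 The lattice estimate for elements of `((p, ξ)A_inf(𝒪))^q` and small perturbations -/

namespace AinfRam

open ValuativeRel Field Ideal WittVector Finset
open Literature.NumberTheory.GaloisRepresentations Literature.NumberTheory.GaloisRepresentations.IsNonarchimedeanLocalField
open GaloisContinuity Literature.RingTheory.FormalGroups

variable {F : Type} [Field F] [ValuativeRel F] [TopologicalSpace F] [IsNonarchimedeanLocalField F]
  [CharZero F] {p : ℕ} [Fact p.Prime] [Fact (¬ IsUnit (p : integerC F))]
  [IsAdicComplete (Ideal.span {(p : integerC F)}) (integerC F)]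
  {hp : valuation F p < 1} (D : EisensteinRoot F p hp) (hθ : Function.Surjective (fontaineTheta (integerC F) p))

/-- ★ **`(1/m)·ι_𝒪(c·x) ∈ Λ(j,k)` for `x ∈ ((p,ξ)A_inf(𝒪))^q`, `q ≥ j + 2r + k + v_p(m)`** (the estimate behind `term_mem_lattice_of_pow_mem`, for an arbitrary
element `x` instead of a power `yᵐ`). [cite: FontaineAsterisque223III, Exp. II §1.5.3] -/
theorem inv_mul_toBdR_mem_lattice_of_mem_idealPXi_pow {k r : ℕ}
    (hr : ∀ x : AinfRam D, ∃ (a : Ainf (p := p) F) (w : BDeRhamPlus (integerC F) p),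
      (p : BDeRhamPlus (integerC F) p) ^ r * toBdR D hθ x = ainfToBdR a + xiBdR ^ k * w)
    {x : AinfRam D} {q : ℕ} (hx : x ∈ idealPXi D ^ q) (c : D.Coeff) {j m : ℕ} (hm : m ≠ 0) (hq : j + 2 * r + k + m.factorization p ≤ q) :
    ∃ (a : Ainf (p := p) F) (w : BDeRhamPlus (integerC F) p),
      qpToBdR ((m : ℚ_[p])⁻¹) * toBdR D hθ (coeffHom D c * x) = ainfToBdR ((p : Ainf (p := p) F) ^ j * a) + xiBdR ^ k * w := by
  classical
  have hkq : k ≤ q := by omega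
  have hjq : (j + 2 * r) + k + m.factorization p ≤ q := by omega
  obtain ⟨g, hg⟩ := exists_inv_natCast_mul_pow_eq (p := p) (j := j + 2 * r) hm hjq
  have hmem : coeffHom D c * x ∈ idealPXi D ^ q := Ideal.mul_mem_left _ _ hx
  have hcoord := repr_mem_of_mem_idealPXi_pow D hmem
  have hterm : ∀ i ∈ (Finset.univ : Finset (Fin (powerBasis D).dim)), ∃ (a : Ainf (p := p) F) (w : BDeRhamPlus (integerC F) p),
      (p : BDeRhamPlus (integerC F) p) ^ r * (qpToBdR ((m : ℚ_[p])⁻¹) *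
        (ainfToBdR ((powerBasis D).basis.repr (coeffHom D c * x) i) * toBdR D hθ (varpi D) ^ (i : ℕ))) =
        ainfToBdR ((p : Ainf (p := p) F) ^ (j + r) * a) + xiBdR ^ k * w := by
    intro i _
    obtain ⟨b, c', hbc⟩ := exists_eq_of_mem_span_p_xi_pow hkq (hcoord i)
    obtain ⟨aϖ, wϖ, hϖ⟩ := hr (varpi D ^ (i : ℕ))
    rw [map_pow] at hϖ
    have h1 : qpToBdR ((m : ℚ_[p])⁻¹) * ainfToBdR ((powerBasis D).basis.repr (coeffHom D c * x) i) =
        ainfToBdR ((p : Ainf (p := p) F) ^ ((j + r) + r) * (zpToAinf g * b)) + xiBdR ^ k * (qpToBdR ((m : ℚ_[p])⁻¹) * ainfToBdR c') := by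
      have hq' : qpToBdR ((m : ℚ_[p])⁻¹) * (p : BDeRhamPlus (integerC F) p) ^ (q - k) =
          ainfToBdR ((p : Ainf (p := p) F) ^ (j + 2 * r) * zpToAinf g) := by
        rw [← map_natCast (qpToBdR (F := F) (p := p)) p, ← map_pow, ← map_mul, hg, map_mul, map_pow, map_natCast, qpToBdR_coe]
        simp only [map_mul, map_pow, map_natCast]
      rw [hbc, map_add, map_mul, map_mul, map_pow, map_natCast, map_pow, ainfToBdR_xi, mul_add, ← mul_assoc, hq',
        show (j + r) + r = j + 2 * r by ring]
      simp only [map_mul, map_pow, map_natCast]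
      ring
    have h2 : (p : BDeRhamPlus (integerC F) p) ^ r * (qpToBdR ((m : ℚ_[p])⁻¹) *
        (ainfToBdR ((powerBasis D).basis.repr (coeffHom D c * x) i) * toBdR D hθ (varpi D) ^ (i : ℕ))) =
        toBdR D hθ (varpi D) ^ (i : ℕ) * ((p : BDeRhamPlus (integerC F) p) ^ r *
          (qpToBdR ((m : ℚ_[p])⁻¹) * ainfToBdR ((powerBasis D).basis.repr (coeffHom D c * x) i))) := by ring
    rw [h2]
    have h3 : (p : BDeRhamPlus (integerC F) p) ^ r * (qpToBdR ((m : ℚ_[p])⁻¹) * ainfToBdR ((powerBasis D).basis.repr (coeffHom D c * x) i)) =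
        ainfToBdR ((p : Ainf (p := p) F) ^ ((j + r) + r) * ((p : Ainf (p := p) F) ^ r * (zpToAinf g * b))) +
          xiBdR ^ k * ((p : BDeRhamPlus (integerC F) p) ^ r * (qpToBdR ((m : ℚ_[p])⁻¹) * ainfToBdR c')) := by
      rw [h1]; simp only [map_mul, map_pow, map_natCast]; ring
    exact lattice_mul_of_bounded hϖ h3
  obtain ⟨a', w', hsum⟩ := lattice_sum (Finset.univ : Finset (Fin (powerBasis D).dim)) hterm
  have hmain : (p : BDeRhamPlus (integerC F) p) ^ r * (qpToBdR ((m : ℚ_[p])⁻¹) * toBdR D hθ (coeffHom D c * x)) =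
      ainfToBdR ((p : Ainf (p := p) F) ^ (j + r) * a') + xiBdR ^ k * w' := by
    rw [toBdR_eq_sum_repr D hθ (coeffHom D c * x), Finset.mul_sum, Finset.mul_sum, hsum]
  obtain ⟨u, hu⟩ : ∃ u : BDeRhamPlus (integerC F) p, (p : BDeRhamPlus (integerC F) p) ^ r * u = 1 := by
    obtain ⟨v, hv⟩ := (isUnit_natCast_bDeRhamPlus (F := F) (p := p) (Fact.out : p.Prime).ne_zero).pow r
    exact ⟨↑v⁻¹, by rw [← hv, Units.mul_inv]⟩
  refine ⟨a', u * w', ?_⟩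
  have e1 : qpToBdR ((m : ℚ_[p])⁻¹) * toBdR D hθ (coeffHom D c * x) =
      u * ((p : BDeRhamPlus (integerC F) p) ^ r * (qpToBdR ((m : ℚ_[p])⁻¹) * toBdR D hθ (coeffHom D c * x))) := by
    rw [← mul_assoc, mul_comm u, hu, one_mul]
  rw [e1, hmain, pow_add]
  simp only [map_mul, map_pow, map_natCast]
  linear_combination (ainfToBdR a' * (p : BDeRhamPlus (integerC F) p) ^ j) * hu

/-- ★ **Small perturbations**: if `δ ∈ ((p,ξ)A_inf(𝒪))^{N′}` with `N′ ≥ j + 2r + k + 1`, then `S_M(β, y + δ) − S_M(β, y) ∈ Λ(j, k)` for ALL `M`, `y`, `β`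
(binomial rearrangement of `BdRPlusRamifiedLogEvalContinuity` + the estimate above: `δ^{l+1}/(l+1)` has `q = N′(l+1) ≥ N′ + l ≥ j + 2r + k + v_p(l+1)`).
[cite: FontaineAsterisque223III, Exp. II §1.5.3] -/
theorem partialSum_add_sub_partialSum_mem_lattice_of_mem_idealPXi_pow {k r : ℕ}
    (hr : ∀ x : AinfRam D, ∃ (a : Ainf (p := p) F) (w : BDeRhamPlus (integerC F) p),
      (p : BDeRhamPlus (integerC F) p) ^ r * toBdR D hθ x = ainfToBdR a + xiBdR ^ k * w)
    (β : ℕ → D.Coeff) (y : AinfRam D) {δ : AinfRam D} {j N' : ℕ} (hN' : j + 2 * r + k + 1 ≤ N') (hδ : δ ∈ idealPXi D ^ N') (M : ℕ) :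
    ∃ (a : Ainf (p := p) F) (w : BDeRhamPlus (integerC F) p),
      (∑ m ∈ Finset.range M, qpToBdR (((m + 1 : ℕ) : ℚ_[p])⁻¹) * toBdR D hθ (coeffHom D (β (m + 1)) * (y + δ) ^ (m + 1))) -
        (∑ m ∈ Finset.range M, qpToBdR (((m + 1 : ℕ) : ℚ_[p])⁻¹) * toBdR D hθ (coeffHom D (β (m + 1)) * y ^ (m + 1))) =
        ainfToBdR ((p : Ainf (p := p) F) ^ j * a) + xiBdR ^ k * w := by
  rw [← Finset.sum_sub_distrib]
  refine lattice_sum _ fun m _ => ?_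
  rw [← mul_sub, ← map_sub, ← mul_sub, inv_mul_toBdR_mul_add_pow_sub_pow]
  refine lattice_sum _ fun l _ => ?_
  have hδl : δ ^ (l + 1) * (coeffHom D (β (m + 1)) * (m.choose l : AinfRam D) * y ^ (m - l)) ∈ idealPXi D ^ (N' * (l + 1)) :=
    Ideal.mul_mem_right _ _ (by rw [pow_mul]; exact Ideal.pow_mem_pow hδ _)
  have hfac : (l + 1).factorization p ≤ l := by
    have := Nat.factorization_lt (n := l + 1) p (Nat.succ_ne_zero l); omega
  have h := inv_mul_toBdR_mem_lattice_of_mem_idealPXi_pow D hθ hr hδl 1 (j := j) (m := l + 1) (Nat.succ_ne_zero l) (by nlinarith)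
  rw [map_one, one_mul] at h
  exact h

/-! ## §4 Additivity of the values along an `𝒪_D`-formal group law, at arbitrary depth -/

/-- The partial sums in the currency of §1: `S_M(β, x) = Σ_{m<M} emb([X^{m+1}]f)·ι_𝒪(x)^{m+1}` when `(1/m)·ι_𝒪(β_m) = emb([Xᵐ]f)`.
[cite: Fontaine1982FormesDifferentielles, §5] -/
theorem partialSum_eq_sum_embBdRHom {f : PowerSeries F} {β : ℕ → D.Coeff}
    (hβ : ∀ m : ℕ, qpToBdR ((m : ℚ_[p])⁻¹) * toBdR D hθ (coeffHom D (β m)) = embBdRHom hp hθ (PowerSeries.coeff m f)) (x : AinfRam D) (M : ℕ) :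
    (∑ m ∈ Finset.range M, qpToBdR (((m + 1 : ℕ) : ℚ_[p])⁻¹) * toBdR D hθ (coeffHom D (β (m + 1)) * x ^ (m + 1))) =
      ∑ m ∈ Finset.range M, embBdRHom hp hθ (PowerSeries.coeff (m + 1) f) * toBdR D hθ x ^ (m + 1) := by
  refine Finset.sum_congr rfl fun m _ => ?_
  rw [map_mul, map_pow, ← mul_assoc, hβ]

omit [CharZero F] [Fact (¬ IsUnit (p : integerC F))] [IsAdicComplete (Ideal.span {(p : integerC F)}) (integerC F)]
  [ValuativeRel F] [TopologicalSpace F] [IsNonarchimedeanLocalField F] in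
/-- Bookkeeping of the denominators against the truncation order: for `M + 1 ≥ N₁·(2N₁(C+N₁) + C + 1)` and `m < M`,
`C + v_p(m+1) ≤ (M+1)/N₁`. [folklore] -/
private theorem add_factorization_le_div {N₁ C M m : ℕ} (hN₁ : 1 ≤ N₁) (hM : N₁ * (2 * N₁ * (C + N₁) + C + 1) ≤ M + 1) (hm : m < M) :
    C + (m + 1).factorization p ≤ (M + 1) / N₁ := by
  have hq : 2 * N₁ * (C + N₁) + C + 1 ≤ (M + 1) / N₁ := (Nat.le_div_iff_mul_le (by omega)).2 (by rw [mul_comm]; exact hM)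
  by_cases hcase : 2 * (C + N₁) ≤ (m + 1) / N₁
  · have h := PadicLogSeries.factorization_add_lt_add_div (p := p) (m := m + 1) (n := C + N₁) hN₁ (by omega) hcase
    have h2 : (m + 1) / N₁ ≤ (M + 1) / N₁ := Nat.div_le_div_right (by omega)
    omega
  · have h1 : (m + 1).factorization p < m + 1 := Nat.factorization_lt p (Nat.succ_ne_zero m)
    have h3 : m + 1 < N₁ * ((m + 1) / N₁ + 1) := by
      have := Nat.div_add_mod (m + 1) N₁
      have := Nat.mod_lt (m + 1) (show 0 < N₁ by omega)
      nlinarith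
    have h4 : N₁ * ((m + 1) / N₁ + 1) ≤ N₁ * (2 * (C + N₁)) := Nat.mul_le_mul_left _ (by omega)
    nlinarith

set_option maxHeartbeats 800000 in
/-- ★★ **ADDITIVITY of the ramified `p`-adic evaluation along an `𝒪_D`-formal group law, at ARBITRARY depth.** Let `f ∈ F⟦X⟧` and `G ∈ 𝒪_D⟦X₀,X₁⟧` (no constant
term) satisfy `f(G) = f(X₀) + f(X₁)` over `F`, let `β : ℕ → 𝒪_D` be numerators of `f` (`(1/m)·ι_𝒪(β_m) = emb([Xᵐ]f)`), and let `y, y′ ∈ Ŵ(𝔫_𝒪)` be ANY two points.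
If `L`, `L′` are values modulo `Fil^k` of `Σ (β_m/m)·ι_𝒪(·)ᵐ` at `y`, `y′`, then **`L + L′` is a value at `y ⊕_G y′ = evalPt G (y, y′)`**: Fontaine's `p`-adic evaluation of a
formal-group logarithm is a homomorphism on ALL of `Ĝ(𝔫_𝒪)`, not only on the deep points. [cite: SilvermanAEC2009, IV.5.2] [cite: Fontaine1982FormesDifferentielles, §5]
[cite: FontaineAsterisque223III, Exp. II §1.5.4] -/
theorem value_evalPt_of_add {k r : ℕ}
    (hr : ∀ x : AinfRam D, ∃ (a : Ainf (p := p) F) (w : BDeRhamPlus (integerC F) p),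
      (p : BDeRhamPlus (integerC F) p) ^ r * toBdR D hθ x = ainfToBdR a + xiBdR ^ k * w)
    (f : PowerSeries F) (β : ℕ → D.Coeff)
    (hβ : ∀ m : ℕ, qpToBdR ((m : ℚ_[p])⁻¹) * toBdR D hθ (coeffHom D (β m)) = embBdRHom hp hθ (PowerSeries.coeff m f))
    {G : MvPowerSeries (Fin 2) (EisensteinRoot.CoeffDisc D)} (hG0 : MvPowerSeries.constantCoeff G = 0)
    (hfG : f.subst (MvPowerSeries.map (EisensteinRoot.CoeffDisc.toF D) G) =
      f.subst (MvPowerSeries.X 0 : MvPowerSeries (Fin 2) F) + f.subst (MvPowerSeries.X 1 : MvPowerSeries (Fin 2) F))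
    (y y' : (AinfRamTop.nilTheta D hθ).toIdeal) {L L' : BDeRhamPlus (integerC F) p}
    (hL : ∀ j : ℕ, ∃ M₀ : ℕ, ∀ M : ℕ, M₀ ≤ M → ∃ (a : Ainf (p := p) F) (w : BDeRhamPlus (integerC F) p),
      L - (∑ m ∈ Finset.range M, qpToBdR (((m + 1 : ℕ) : ℚ_[p])⁻¹) *
        toBdR D hθ (coeffHom D (β (m + 1)) * (AinfRamTop.of D).symm (y : AinfRamTop D) ^ (m + 1))) =
        ainfToBdR ((p : Ainf (p := p) F) ^ j * a) + xiBdR ^ k * w)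
    (hL' : ∀ j : ℕ, ∃ M₀ : ℕ, ∀ M : ℕ, M₀ ≤ M → ∃ (a : Ainf (p := p) F) (w : BDeRhamPlus (integerC F) p),
      L' - (∑ m ∈ Finset.range M, qpToBdR (((m + 1 : ℕ) : ℚ_[p])⁻¹) *
        toBdR D hθ (coeffHom D (β (m + 1)) * (AinfRamTop.of D).symm (y' : AinfRamTop D) ^ (m + 1))) =
        ainfToBdR ((p : Ainf (p := p) F) ^ j * a) + xiBdR ^ k * w) :
    ∀ j : ℕ, ∃ M₀ : ℕ, ∀ M : ℕ, M₀ ≤ M → ∃ (a : Ainf (p := p) F) (w : BDeRhamPlus (integerC F) p),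
      (L + L') - (∑ m ∈ Finset.range M, qpToBdR (((m + 1 : ℕ) : ℚ_[p])⁻¹) *
        toBdR D hθ (coeffHom D (β (m + 1)) *
          (AinfRamTop.of D).symm ((LubinTate.evalPt (AinfRamTop.nilTheta D hθ) G hG0 ![y, y'] : (AinfRamTop.nilTheta D hθ).toIdeal) : AinfRamTop D) ^ (m + 1))) =
        ainfToBdR ((p : Ainf (p := p) F) ^ j * a) + xiBdR ^ k * w := by
  classical
  -- the two points as a `Fin 2`-family, the ring maps `τ = ι_𝒪 ∘ of⁻¹`, `eA = τ ∘ (𝒪_D → A_inf(𝒪))`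
  set xx : Fin 2 → (AinfRamTop.nilTheta D hθ).toIdeal := ![y, y'] with hxx
  set g : AinfRamTop D := ((LubinTate.evalPt (AinfRamTop.nilTheta D hθ) G hG0 xx : (AinfRamTop.nilTheta D hθ).toIdeal) : AinfRamTop D)
    with hg
  set τ : AinfRamTop D →+* BDeRhamPlus (integerC F) p := (toBdR D hθ).comp (AinfRamTop.of D).symm.toRingHom with hτ
  have hτapp : ∀ a : AinfRamTop D, τ a = toBdR D hθ ((AinfRamTop.of D).symm a) := fun a => rfl
  set eA : EisensteinRoot.CoeffDisc D →+* BDeRhamPlus (integerC F) p := τ.comp (algebraMap (EisensteinRoot.CoeffDisc D) (AinfRamTop D))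
    with heA
  have heA' : (embBdRHom hp hθ).comp (EisensteinRoot.CoeffDisc.toF D) = eA := by
    refine RingHom.ext fun c => ?_
    change embBdRHom hp hθ (EisensteinRoot.Coeff.toF D ((EisensteinRoot.CoeffDisc.of D).symm c)) =
      toBdR D hθ (coeffHom D ((EisensteinRoot.CoeffDisc.of D).symm c))
    rw [toBdR_coeffHom]
  set z : Fin 2 → BDeRhamPlus (integerC F) p := fun i => τ (xx i : AinfRamTop D) with hz
  -- a common depth `N ≥ 1` of `y`, `y'`
  obtain ⟨N₀, hN₀1, hN₀⟩ := AinfRamTop.exists_pos_pow_mem_ideal (D := D) (hθ := hθ) y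
  obtain ⟨N₀', hN₀'1, hN₀'⟩ := AinfRamTop.exists_pos_pow_mem_ideal (D := D) (hθ := hθ) y'
  set N : ℕ := N₀ * N₀' with hN
  have hN1 : 1 ≤ N := Nat.one_le_iff_ne_zero.2 (Nat.mul_ne_zero (by omega) (by omega))
  have hxN : ∀ i, (xx i : AinfRamTop D) ^ N ∈ (WithIdeal.i : Ideal (AinfRamTop D)) := by
    intro i; fin_cases i
    · change (y : AinfRamTop D) ^ N ∈ _
      rw [hN, pow_mul]; exact Ideal.pow_mem_of_mem _ hN₀ _ (by omega)
    · change (y' : AinfRamTop D) ^ N ∈ _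
      rw [hN, mul_comm, pow_mul]; exact Ideal.pow_mem_of_mem _ hN₀' _ (by omega)
  have hJ : (Ideal.span {(xx 0 : AinfRamTop D)} ⊔ Ideal.span {(xx 1 : AinfRamTop D)}) ^ (N + N) ≤ (WithIdeal.i : Ideal (AinfRamTop D)) :=
    AinfRamTop.sup_span_pow_le_of_pow_mem' (hxN 0) (hxN 1)
  have hyI : ∀ i : Fin 2, (xx i : AinfRamTop D) ∈ Ideal.span {(xx 0 : AinfRamTop D)} ⊔ Ideal.span {(xx 1 : AinfRamTop D)} := by
    intro i; fin_cases i
    · exact Ideal.mem_sup_left (Ideal.mem_span_singleton_self _)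
    · exact Ideal.mem_sup_right (Ideal.mem_span_singleton_self _)
  -- the conversion exponent `c₀` (`(p,ω)^{c₀} ⊆ (p,ξ)A_inf(𝒪)`) and `N₁ = 2N·c₀`
  set c₀ : ℕ := 1 + (D.e + D.e - 1) with hc₀
  set N₁ : ℕ := (N + N) * c₀ with hN₁
  have hc₀1 : 1 ≤ c₀ := by omega
  have hN₁1 : 1 ≤ N₁ := Nat.one_le_iff_ne_zero.2 (Nat.mul_ne_zero (by omega) (by omega))
  intro j
  set C : ℕ := j + 2 * r + k with hC
  obtain ⟨M₀, hM₀⟩ := hL j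
  obtain ⟨M₀', hM₀'⟩ := hL' j
  refine ⟨max (max M₀ M₀') (N₁ * (2 * N₁ * (C + N₁) + C + 1)), fun M hM => ?_⟩
  obtain ⟨a₁, w₁, h1⟩ := hM₀ M ((le_max_left _ _).trans ((le_max_left _ _).trans hM))
  obtain ⟨a₂, w₂, h2⟩ := hM₀' M ((le_max_right _ _).trans ((le_max_left _ _).trans hM))
  have hMbig : N₁ * (2 * N₁ * (C + N₁) + C + 1) ≤ M + 1 := ((le_max_right _ _).trans hM).trans (Nat.le_succ M)
  -- truncation depth `T ≥ M`, fine enough for the truncation error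
  set T : ℕ := max M (N₁ * (C + 1)) with hT
  have hMT : M ≤ T := le_max_left _ _
  set gT : AinfRamTop D := MvPolynomial.aeval (fun i => (xx i : AinfRamTop D)) (truncTotal (T + 1) G) with hgT
  have herr : g - gT ∈ (WithIdeal.i : Ideal (AinfRamTop D)) ^ ((T + 1) / (N + N)) :=
    AinfRamTop.coe_evalPt_sub_aeval_truncTotal_mem_pow_div G hG0 xx hxN T
  have herr' : (AinfRamTop.of D).symm (g - gT) ∈ idealPXi D ^ (C + 1) := by
    refine AinfRamTop.of_symm_mem_idealPXi_pow (Ideal.pow_le_pow_right ?_ herr)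
    refine (Nat.le_div_iff_mul_le (by omega)).2 ?_
    have hT2 : N₁ * (C + 1) ≤ T := le_max_right _ _
    rw [hN₁] at hT2
    nlinarith
  -- (h4) the truncation error is invisible modulo `Λ(j, k)`
  obtain ⟨a₄, w₄, h4⟩ := partialSum_add_sub_partialSum_mem_lattice_of_mem_idealPXi_pow D hθ hr β ((AinfRamTop.of D).symm gT)
    (j := j) (N' := C + 1) (by omega) herr' M
  have hgsplit : (AinfRamTop.of D).symm gT + (AinfRamTop.of D).symm (g - gT) = (AinfRamTop.of D).symm g := by
    rw [← map_add, add_sub_cancel]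
  rw [hgsplit] at h4
  -- (h3) the truncated functional equation: the defect is a sum of small `H`-terms
  have hzT : toBdR D hθ ((AinfRamTop.of D).symm gT) = MvPolynomial.eval₂ eA z (truncTotal (T + 1) G) := by
    rw [← hτapp, hgT, MvPolynomial.map_aeval, MvPolynomial.coe_eval₂Hom]
  have h3 : ∃ (a : Ainf (p := p) F) (w : BDeRhamPlus (integerC F) p),
      (∑ m ∈ Finset.range M, qpToBdR (((m + 1 : ℕ) : ℚ_[p])⁻¹) * toBdR D hθ (coeffHom D (β (m + 1)) * (AinfRamTop.of D).symm gT ^ (m + 1))) -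
        (∑ m ∈ Finset.range M, qpToBdR (((m + 1 : ℕ) : ℚ_[p])⁻¹) * toBdR D hθ (coeffHom D (β (m + 1)) * (AinfRamTop.of D).symm (y : AinfRamTop D) ^ (m + 1))) -
        (∑ m ∈ Finset.range M, qpToBdR (((m + 1 : ℕ) : ℚ_[p])⁻¹) * toBdR D hθ (coeffHom D (β (m + 1)) * (AinfRamTop.of D).symm (y' : AinfRamTop D) ^ (m + 1))) =
        ainfToBdR ((p : Ainf (p := p) F) ^ j * a) + xiBdR ^ k * w := by
    rw [partialSum_eq_sum_embBdRHom D hθ hβ, partialSum_eq_sum_embBdRHom D hθ hβ, partialSum_eq_sum_embBdRHom D hθ hβ, hzT,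
      show toBdR D hθ ((AinfRamTop.of D).symm (y : AinfRamTop D)) = z 0 from rfl,
      show toBdR D hθ ((AinfRamTop.of D).symm (y' : AinfRamTop D)) = z 1 from rfl,
      RamLogTypeSeries.eval₂_sum_truncTotal_sub (EisensteinRoot.CoeffDisc.toF D) (embBdRHom hp hθ) eA heA' f hG0 hfG hMT z]
    refine lattice_sum _ fun m hm => ?_
    have hH : MvPolynomial.eval₂ eA z (truncTotal (T + 1) G ^ (m + 1) -
        truncTotal (M + 1) ((truncTotal (T + 1) G ^ (m + 1) : MvPolynomial (Fin 2) (EisensteinRoot.CoeffDisc D)) :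
          MvPowerSeries (Fin 2) (EisensteinRoot.CoeffDisc D))) =
        toBdR D hθ ((AinfRamTop.of D).symm (MvPolynomial.aeval (fun i => (xx i : AinfRamTop D)) (truncTotal (T + 1) G ^ (m + 1) -
          truncTotal (M + 1) ((truncTotal (T + 1) G ^ (m + 1) : MvPolynomial (Fin 2) (EisensteinRoot.CoeffDisc D)) :
            MvPowerSeries (Fin 2) (EisensteinRoot.CoeffDisc D))))) := by
      rw [← hτapp, MvPolynomial.map_aeval, MvPolynomial.coe_eval₂Hom]
    rw [hH, ← hβ, mul_assoc, ← map_mul]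
    refine inv_mul_toBdR_mem_lattice_of_mem_idealPXi_pow D hθ hr (q := (M + 1) / N₁) ?_ (β (m + 1)) (Nat.succ_ne_zero m) ?_
    · refine AinfRamTop.of_symm_mem_idealPXi_pow ?_
      have hH1 : MvPolynomial.aeval (fun i => (xx i : AinfRamTop D)) (truncTotal (T + 1) G ^ (m + 1) -
          truncTotal (M + 1) ((truncTotal (T + 1) G ^ (m + 1) : MvPolynomial (Fin 2) (EisensteinRoot.CoeffDisc D)) :
            MvPowerSeries (Fin 2) (EisensteinRoot.CoeffDisc D))) ∈
          (Ideal.span {(xx 0 : AinfRamTop D)} ⊔ Ideal.span {(xx 1 : AinfRamTop D)}) ^ (M + 1) := by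
        rw [MvPolynomial.aeval_def]
        exact RamLogTypeSeries.eval₂_pow_sub_truncTotal_mem_pow _ hyI G M T (m + 1)
      have hle : (Ideal.span {(xx 0 : AinfRamTop D)} ⊔ Ideal.span {(xx 1 : AinfRamTop D)}) ^ (M + 1) ≤
          (WithIdeal.i : Ideal (AinfRamTop D)) ^ ((1 + (D.e + D.e - 1)) * ((M + 1) / N₁)) := by
        have hdiv : (1 + (D.e + D.e - 1)) * ((M + 1) / N₁) ≤ (M + 1) / (N + N) := by
          rw [← hc₀, hN₁, ← Nat.div_div_eq_div_mul]; exact Nat.mul_div_le _ _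
        refine (Ideal.pow_le_pow_right (Nat.mul_div_le (M + 1) (N + N))).trans ?_
        rw [pow_mul]
        exact (Ideal.pow_right_mono hJ _).trans (Ideal.pow_le_pow_right hdiv)
      exact hle hH1
    · exact add_factorization_le_div (p := p) hN₁1 hMbig (Finset.mem_range.1 hm)
  obtain ⟨a₃, w₃, h3⟩ := h3
  refine ⟨a₁ + a₂ - a₃ - a₄, w₁ + w₂ - w₃ - w₄, ?_⟩
  have e : L + L' - (∑ m ∈ Finset.range M, qpToBdR (((m + 1 : ℕ) : ℚ_[p])⁻¹) *
      toBdR D hθ (coeffHom D (β (m + 1)) * (AinfRamTop.of D).symm g ^ (m + 1))) =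
      (L - ∑ m ∈ Finset.range M, qpToBdR (((m + 1 : ℕ) : ℚ_[p])⁻¹) * toBdR D hθ (coeffHom D (β (m + 1)) * (AinfRamTop.of D).symm (y : AinfRamTop D) ^ (m + 1))) +
      (L' - ∑ m ∈ Finset.range M, qpToBdR (((m + 1 : ℕ) : ℚ_[p])⁻¹) * toBdR D hθ (coeffHom D (β (m + 1)) * (AinfRamTop.of D).symm (y' : AinfRamTop D) ^ (m + 1))) -
      ((∑ m ∈ Finset.range M, qpToBdR (((m + 1 : ℕ) : ℚ_[p])⁻¹) * toBdR D hθ (coeffHom D (β (m + 1)) * (AinfRamTop.of D).symm gT ^ (m + 1))) -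
        (∑ m ∈ Finset.range M, qpToBdR (((m + 1 : ℕ) : ℚ_[p])⁻¹) * toBdR D hθ (coeffHom D (β (m + 1)) * (AinfRamTop.of D).symm (y : AinfRamTop D) ^ (m + 1))) -
        (∑ m ∈ Finset.range M, qpToBdR (((m + 1 : ℕ) : ℚ_[p])⁻¹) * toBdR D hθ (coeffHom D (β (m + 1)) * (AinfRamTop.of D).symm (y' : AinfRamTop D) ^ (m + 1)))) -
      ((∑ m ∈ Finset.range M, qpToBdR (((m + 1 : ℕ) : ℚ_[p])⁻¹) * toBdR D hθ (coeffHom D (β (m + 1)) * (AinfRamTop.of D).symm g ^ (m + 1))) -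
        (∑ m ∈ Finset.range M, qpToBdR (((m + 1 : ℕ) : ℚ_[p])⁻¹) * toBdR D hθ (coeffHom D (β (m + 1)) * (AinfRamTop.of D).symm gT ^ (m + 1)))) := by
    ring
  rw [e, h1, h2, h3, h4]
  simp only [map_add, map_sub, map_mul, map_pow, map_natCast]
  ring

end AinfRam

end Literature.NumberTheory.PAdicHodge

end
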